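import Mathlib
import HarnessLib
import Summits.HubbardSuperconductivity.HubbardSuperconductivity.Theorems.KLProgrammeH10TwoPointLimitPerturbedCountCooper
import Summits.HubbardSuperconductivity.HubbardSuperconductivity.Theorems.KLProgrammeH10TwoPointLimitPerturbedFermiRadiusAccelBand

/-!
# Route `KLProgramme` — crux K1 `H10TwoPointLimit` (stmt-HubbardSuperconductivity-19938):
# the fold key bound ON THE PERTURBED CURVE (the tree's `even_key`, BGM App. A2 region `R₂`, even shift)

Fourth (S)-lemma of the port HOME/prover-p4/PORT-NOTE.md (architecture (β)), after `cover_perturbed` and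
`odd_transversal_perturbed`. For a root selection `u` of the perturbed curve `{ε₀ + δ = μ}` (`δ ∈ C²`, `|δ| ≤ κ₀`,
`‖Dδ‖ ≤ κ₁ < Dt_min`, `‖D(Dδ)‖ ≤ κ₂` on all of `ℝ²` — for the `2π`-periodic perturbations of the programme, the bounds on one cell),
with the velocities `X_E', Y_E'` of the perturbed curve and the `Dδ` terms of the perturbed partial derivatives INCLUDED:
`even_key_perturbed` — the lineage's `even_key_offset` on the moving curve: on the anti-diagonal `(σ - t/2, σ + t/2)`, `0 < t ≤ τ`,
if the sum of the two perturbed partials is `≤ 4λ` in modulus then the `t`-derivative of the perturbed level function (frozen sines,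
including its `Dδ(S)[(p_E'(σ + t/2) - p_E'(σ - t/2))/2]` term) is `≥ (h_min/2) t` in modulus, at the price of an explicit
`O(κ₀ + κ₁ + κ₂ + η₀ + λ + τ)` loss absorbed by the smallness hypothesis, written — as in `odd_transversal_perturbed` — in the
expanded constants `C_V = κ₁(π√2 + 2s_max)/(Dt_min - κ₁)`, `S_E = s_max + C_V`, `U₁ = (4+κ₁)π√2/(Dt_min - κ₁)`,
`U₂ = ((4+κ₂)S_E² + (8+2κ₁)U₁ + (4+κ₁)π√2)/(Dt_min - κ₁)`, `A_E = U₂ + 2U₁ + π√2`.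
Proof = the lineage's, step for step, with every free fact replaced by its landed perturbed counterpart (leg alignment
`exists_int_near_of_h3E_small`, velocity Lipschitz `abs_VXE_sub_VXE_le`, `(d/dθ)X_E' = X_E''` `hasDerivAt_VXE`, sign alignment at the
shifted level, `abs_sin_mul_accel_ge`). Plus three lines of linearity bookkeeping for functionals on `ℝ²` (`clm_vec2_add/sub/smul`).
Everything is PROVED; no definitions.
References: BGM 2006 App. A2 [cite: BenfattoGiulianiMastropietro2006]; HOME/prover-p4/COUNTING-NOTE.md (the offset scheme).
-/

noncomputable section

namespace Summit.HubbardSuperconductivity.HubbardSuperconductivity.Theorems.PerturbedFermiCurve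

set_option linter.dupNamespace false -- summit = problem name (single-conjunct summit), D-0017

open Real Set
open Literature.MathematicalPhysics.QuantumLattice Literature.MathematicalPhysics.QuantumLattice.BandSectorCounting

/-- Linearity bookkeeping: `L(a,b) + L(c,d) = L(a+c, b+d)` for a linear functional on `ℝ²`. [folklore] -/
theorem clm_vec2_add (L : (Fin 2 → ℝ) →L[ℝ] ℝ) (a b c d : ℝ) : L ![a, b] + L ![c, d] = L ![a + c, b + d] := by
  rw [← map_add]; congr 1; ext i; fin_cases i <;> simp

/-- Linearity bookkeeping: `L(a,b) - L(c,d) = L(a-c, b-d)`. [folklore] -/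
theorem clm_vec2_sub (L : (Fin 2 → ℝ) →L[ℝ] ℝ) (a b c d : ℝ) : L ![a, b] - L ![c, d] = L ![a - c, b - d] := by
  rw [← map_sub]; congr 1; ext i; fin_cases i <;> simp

/-- Linearity bookkeeping: `r L(a,b) = L(ra, rb)`. [folklore] -/
theorem clm_vec2_smul (L : (Fin 2 → ℝ) →L[ℝ] ℝ) (r a b : ℝ) : r * L ![a, b] = L ![r * a, r * b] := by
  have h : (![r * a, r * b] : Fin 2 → ℝ) = r • ![a, b] := by ext i; fin_cases i <;> simp
  rw [h, map_smul, smul_eq_mul]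

section Fold

variable {a b : ℝ} (B : BandBounds a b) {δ : (Fin 2 → ℝ) → ℝ} (hδs : ContDiff ℝ 2 δ)
  {κ₀ κ₁ κ₂ μ : ℝ} (hδ : ∀ k : Fin 2 → ℝ, |δ k| ≤ κ₀) (hlo : a ≤ μ - κ₀) (hhi : μ + κ₀ ≤ b)
  (hκ : ∀ k : Fin 2 → ℝ, ‖fderiv ℝ δ k‖ ≤ κ₁) (hκ₁ : κ₁ < B.Dtmin) (hκ₂ : ∀ k : Fin 2 → ℝ, ‖fderiv ℝ (fderiv ℝ δ) k‖ ≤ κ₂)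
  {u : ℝ → ℝ} (hu : ∀ θ, IsBandFermiRadius (μ - δ (u θ • dir θ)) θ (u θ))
include B hδs hδ hlo hhi hκ hκ₁ hκ₂ hu

/-- **The fold-in-`t` key lower bound on the perturbed curve** (the tree's `even_key` / the lineage's `even_key_offset` for the
moving curve). For reals `S_x, S_y` with `|ε₂(S_x,S_y) - μ'| ≤ η₀` at a level `μ'` with `|μ' - ν(θ)| ≤ 2κ₀` for all shifted
levels (in the application `μ' = μ - δ(S)`), on the anti-diagonal `(σ - t/2, σ + t/2)`, `0 < t ≤ τ`: if the sum of the two perturbed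
partials (frozen sines) is `≤ 4λ` in modulus, then the perturbed `t`-derivative is `≥ (h_min/2) t` in modulus, under the smallness
`4C_V(S_E + s_max) + (κ₂S_E² + κ₁A_E)/2 + 2A_E e_tot + κ₁A_E/2 ≤ h_min/2`, `e_tot = η₀/Dt_min + 2κ₀/Dt_min + s_max(C_g ε₄ + τ/2)`,
`ε₄ = λ'/2 + κ₁S_E/2 + 2C_V + 2s_max η₀/Dt_min + 4s_max κ₀/Dt_min`, `λ' = 2λ + (4+κ₁)A_E τ/2`.
[cite: BenfattoGiulianiMastropietro2006, App. A2] -/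
theorem even_key_perturbed {Sx Sy μ' σ t τ η₀ lam : ℝ} (ht0 : 0 < t) (htτ : t ≤ τ) (hμ' : μ' ∈ Icc a b)
    (hlo' : a ≤ μ' - η₀) (hhi' : μ' + η₀ ≤ b) (hh' : |eps2 Sx Sy - μ'| ≤ η₀)
    (hgap : ∀ θ, |μ' - (μ - δ (u θ • dir θ))| ≤ 2 * κ₀) {S : Fin 2 → ℝ}
    (hG : |(2 * Real.sin Sx * VXE u (σ - t / 2) + 2 * Real.sin Sy * VYE u (σ - t / 2) +
            fderiv ℝ δ S ![VXE u (σ - t / 2), VYE u (σ - t / 2)]) +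
          (2 * Real.sin Sx * VXE u (σ + t / 2) + 2 * Real.sin Sy * VYE u (σ + t / 2) +
            fderiv ℝ δ S ![VXE u (σ + t / 2), VYE u (σ + t / 2)])| ≤ 4 * lam)
    (hsmall :
      4 * (κ₁ * (π * Real.sqrt 2 + 2 * B.smax) / (B.Dtmin - κ₁)) * ((B.smax + κ₁ * (π * Real.sqrt 2 + 2 * B.smax) / (B.Dtmin - κ₁)) + B.smax) +
          (κ₂ * (B.smax + κ₁ * (π * Real.sqrt 2 + 2 * B.smax) / (B.Dtmin - κ₁)) ^ 2 + κ₁ * ((((4 + κ₂) * (B.smax + κ₁ * (π * Real.sqrt 2 + 2 * B.smax) / (B.Dtmin - κ₁)) ^ 2 + (8 + 2 * κ₁) * ((4 + κ₁) * (π * Real.sqrt 2) / (B.Dtmin - κ₁)) + (4 + κ₁) * (π * Real.sqrt 2)) / (B.Dtmin - κ₁)) + 2 * ((4 + κ₁) * (π * Real.sqrt 2) / (B.Dtmin - κ₁)) + π * Real.sqrt 2)) / 2 +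
        2 * ((((4 + κ₂) * (B.smax + κ₁ * (π * Real.sqrt 2 + 2 * B.smax) / (B.Dtmin - κ₁)) ^ 2 + (8 + 2 * κ₁) * ((4 + κ₁) * (π * Real.sqrt 2) / (B.Dtmin - κ₁)) + (4 + κ₁) * (π * Real.sqrt 2)) / (B.Dtmin - κ₁)) + 2 * ((4 + κ₁) * (π * Real.sqrt 2) / (B.Dtmin - κ₁)) + π * Real.sqrt 2) *
          (η₀ / B.Dtmin + 2 * κ₀ / B.Dtmin + B.smax * (B.Cg * ((2 * lam + (4 + κ₁) * ((((4 + κ₂) * (B.smax + κ₁ * (π * Real.sqrt 2 + 2 * B.smax) / (B.Dtmin - κ₁)) ^ 2 + (8 + 2 * κ₁) * ((4 + κ₁) * (π * Real.sqrt 2) / (B.Dtmin - κ₁)) + (4 + κ₁) * (π * Real.sqrt 2)) / (B.Dtmin - κ₁)) + 2 * ((4 + κ₁) * (π * Real.sqrt 2) / (B.Dtmin - κ₁)) + π * Real.sqrt 2) * τ / 2) / 2 + κ₁ * (B.smax + κ₁ * (π * Real.sqrt 2 + 2 * B.smax) / (B.Dtmin - κ₁)) / 2 + 2 * (κ₁ *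 (π * Real.sqrt 2 + 2 * B.smax) / (B.Dtmin - κ₁)) + 2 * B.smax * (η₀ / B.Dtmin) + 2 * B.smax * (2 * κ₀ / B.Dtmin)) + τ / 2)) +
        κ₁ * ((((4 + κ₂) * (B.smax + κ₁ * (π * Real.sqrt 2 + 2 * B.smax) / (B.Dtmin - κ₁)) ^ 2 + (8 + 2 * κ₁) * ((4 + κ₁) * (π * Real.sqrt 2) / (B.Dtmin - κ₁)) + (4 + κ₁) * (π * Real.sqrt 2)) / (B.Dtmin - κ₁)) + 2 * ((4 + κ₁) * (π * Real.sqrt 2) / (B.Dtmin - κ₁)) + π * Real.sqrt 2) / 2 ≤ B.hmin / 2) :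
    B.hmin / 2 * t ≤ |Real.sin Sx * (VXE u (σ + t / 2) - VXE u (σ - t / 2)) +
        Real.sin Sy * (VYE u (σ + t / 2) - VYE u (σ - t / 2)) +
        fderiv ℝ δ S ![(VXE u (σ + t / 2) - VXE u (σ - t / 2)) / 2, (VYE u (σ + t / 2) - VYE u (σ - t / 2)) / 2]| := by
  have h2ne : (2 : WithTop ℕ∞) ≠ 0 := by norm_num
  have hδ' : ∀ k : Fin 2 → ℝ, (∀ i, |k i| ≤ π) → |δ k| ≤ κ₀ := fun k _ => hδ k
  have hκ' : ∀ k : Fin 2 → ℝ, (∀ i, |k i| ≤ π) → ‖fderiv ℝ δ k‖ ≤ κ₁ := fun k _ => hκ k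
  have hκ₂' : ∀ k : Fin 2 → ℝ, (∀ i, |k i| ≤ π) → ‖fderiv ℝ (fderiv ℝ δ) k‖ ≤ κ₂ := fun k _ => hκ₂ k
  have hs := B.smax_pos; have hDt := B.Dtmin_pos; have hCg := B.Cg_pos
  have hden : 0 < B.Dtmin - κ₁ := sub_pos.2 hκ₁
  have hκ₁0 : 0 ≤ κ₁ := (norm_nonneg _).trans (hκ S)
  have hκ₂0 : 0 ≤ κ₂ := (norm_nonneg (fderiv ℝ (fderiv ℝ δ) S)).trans (hκ₂ S)
  have hτ : 0 < τ := ht0.trans_le htτ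
  have ht2 : 0 < t / 2 := half_pos ht0
  -- lemma instances carrying the constants (instantiated BEFORE abbreviating)
  obtain ⟨hvm, hwm⟩ := abs_VXE_sub_VXE_le B hδs hδ hlo hhi hκ hκ₁ hκ₂ hu σ (σ - t / 2)
  obtain ⟨hvp, hwp⟩ := abs_VXE_sub_VXE_le B hδs hδ hlo hhi hκ hκ₁ hκ₂ hu σ (σ + t / 2)
  obtain ⟨hvpm, hwpm⟩ := abs_VXE_sub_VXE_le B hδs hδ hlo hhi hκ hκ₁ hκ₂ hu (σ + t / 2) (σ - t / 2)
  rw [show σ - (σ - t / 2) = t / 2 by ring, abs_of_pos ht2] at hvm hwm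
  rw [show σ - (σ + t / 2) = -(t / 2) by ring, abs_neg, abs_of_pos ht2] at hvp hwp
  rw [show σ + t / 2 - (σ - t / 2) = t by ring, abs_of_pos ht0] at hvpm hwpm
  -- the frozen-coefficient mean value theorem on `[σ - t/2, σ + t/2]`
  have hu2 : ContDiff ℝ 2 u := contDiff_of_isRoot B hδs h2ne hδ' hlo hhi hκ' hκ₁ hu
  have hud : ∀ x, DifferentiableAt ℝ u x := fun x => (hu2.differentiable h2ne) x
  have hud' : ∀ x, DifferentiableAt ℝ (deriv u) x := by
    have h2 : ContDiff ℝ ((1 : WithTop ℕ∞) + 1) u := by rw [one_add_one_eq_two]; exact hu2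
    have h : ContDiff ℝ 1 (deriv u) := (contDiff_succ_iff_deriv.1 h2).2.2
    exact fun x => (h.differentiable one_ne_zero) x
  have hfd : ∀ x, HasDerivAt (fun x => Real.sin Sx * VXE u x + Real.sin Sy * VYE u x)
      (Real.sin Sx * (deriv (deriv u) x * Real.cos x - 2 * deriv u x * Real.sin x - u x * Real.cos x) +
        Real.sin Sy * (deriv (deriv u) x * Real.sin x + 2 * deriv u x * Real.cos x - u x * Real.sin x)) x := fun x =>
    ((hasDerivAt_VXE (hud x) (hud' x)).const_mul (Real.sin Sx)).add
      ((hasDerivAt_VYE (hud x) (hud' x)).const_mul (Real.sin Sy))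
  obtain ⟨ξ, hξ, hslope⟩ := exists_slope hfd (σ - t / 2) t
  rw [show σ - t / 2 + t = σ + t / 2 by ring] at hslope
  obtain ⟨hAXb, hAYb⟩ := abs_accel_le B hδs hδ hlo hhi hκ hκ₁ hκ₂ hu ξ
  have hcoreE := abs_sin_mul_accel_ge B hδs hδ' hlo hhi hκ' hκ₁ hκ₂' hu ξ
  set AX := deriv (deriv u) ξ * Real.cos ξ - 2 * deriv u ξ * Real.sin ξ - u ξ * Real.cos ξ with hAX
  set AY := deriv (deriv u) ξ * Real.sin ξ + 2 * deriv u ξ * Real.cos ξ - u ξ * Real.sin ξ with hAY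
  -- constants (abbreviated, then made opaque)
  set CV := κ₁ * (π * Real.sqrt 2 + 2 * B.smax) / (B.Dtmin - κ₁) with hCV
  set SE := B.smax + CV with hSE
  set U1 := (4 + κ₁) * (π * Real.sqrt 2) / (B.Dtmin - κ₁) with hU1
  set U2 := ((4 + κ₂) * SE ^ 2 + (8 + 2 * κ₁) * U1 + (4 + κ₁) * (π * Real.sqrt 2)) / (B.Dtmin - κ₁) with hU2
  set AE := U2 + 2 * U1 + π * Real.sqrt 2 with hAE
  set lam' := 2 * lam + (4 + κ₁) * AE * τ / 2 with hlam'
  set ε4 := lam' / 2 + κ₁ * SE / 2 + 2 * CV + 2 * B.smax * (η₀ / B.Dtmin) + 2 * B.smax * (2 * κ₀ / B.Dtmin) with hε4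
  set etot := η₀ / B.Dtmin + 2 * κ₀ / B.Dtmin + B.smax * (B.Cg * ε4 + τ / 2) with hetot
  clear_value etot ε4 lam' AE U2 U1 SE CV
  have hAE0 : 0 ≤ AE := (abs_nonneg _).trans hAXb
  -- Step 1: the perturbed partial at the midpoint `σ` is small
  have hmid : |2 * Real.sin Sx * VXE u σ + 2 * Real.sin Sy * VYE u σ + fderiv ℝ δ S ![VXE u σ, VYE u σ]| ≤ lam' := by
    have ex : |2 * VXE u σ - VXE u (σ - t / 2) - VXE u (σ + t / 2)| ≤ AE * t := by
      rw [show 2 * VXE u σ - VXE u (σ - t / 2) - VXE u (σ + t / 2) =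
        (VXE u σ - VXE u (σ - t / 2)) + (VXE u σ - VXE u (σ + t / 2)) by ring]
      refine (abs_add_le _ _).trans ?_; linarith
    have ey : |2 * VYE u σ - VYE u (σ - t / 2) - VYE u (σ + t / 2)| ≤ AE * t := by
      rw [show 2 * VYE u σ - VYE u (σ - t / 2) - VYE u (σ + t / 2) =
        (VYE u σ - VYE u (σ - t / 2)) + (VYE u σ - VYE u (σ + t / 2)) by ring]
      refine (abs_add_le _ _).trans ?_; linarith
    have hD : |fderiv ℝ δ S ![2 * VXE u σ - VXE u (σ - t / 2) - VXE u (σ + t / 2),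
        2 * VYE u σ - VYE u (σ - t / 2) - VYE u (σ + t / 2)]| ≤ κ₁ * (AE * t) :=
      abs_fderiv_vec2_le (hκ S) (by positivity) ex ey
    have hx : |2 * Real.sin Sx * (2 * VXE u σ - VXE u (σ - t / 2) - VXE u (σ + t / 2))| ≤ 2 * (AE * t) := by
      rw [abs_mul, abs_mul, abs_two]
      have h3 : |Real.sin Sx| * |2 * VXE u σ - VXE u (σ - t / 2) - VXE u (σ + t / 2)| ≤ 1 * (AE * t) :=
        mul_le_mul (Real.abs_sin_le_one Sx) ex (abs_nonneg _) zero_le_one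
      linarith
    have hy : |2 * Real.sin Sy * (2 * VYE u σ - VYE u (σ - t / 2) - VYE u (σ + t / 2))| ≤ 2 * (AE * t) := by
      rw [abs_mul, abs_mul, abs_two]
      have h3 : |Real.sin Sy| * |2 * VYE u σ - VYE u (σ - t / 2) - VYE u (σ + t / 2)| ≤ 1 * (AE * t) :=
        mul_le_mul (Real.abs_sin_le_one Sy) ey (abs_nonneg _) zero_le_one
      linarith
    have hid : 2 * (2 * Real.sin Sx * VXE u σ + 2 * Real.sin Sy * VYE u σ + fderiv ℝ δ S ![VXE u σ, VYE u σ]) -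
        ((2 * Real.sin Sx * VXE u (σ - t / 2) + 2 * Real.sin Sy * VYE u (σ - t / 2) +
            fderiv ℝ δ S ![VXE u (σ - t / 2), VYE u (σ - t / 2)]) +
          (2 * Real.sin Sx * VXE u (σ + t / 2) + 2 * Real.sin Sy * VYE u (σ + t / 2) +
            fderiv ℝ δ S ![VXE u (σ + t / 2), VYE u (σ + t / 2)])) =
        2 * Real.sin Sx * (2 * VXE u σ - VXE u (σ - t / 2) - VXE u (σ + t / 2)) +
          2 * Real.sin Sy * (2 * VYE u σ - VYE u (σ - t / 2) - VYE u (σ + t / 2)) +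
          fderiv ℝ δ S ![2 * VXE u σ - VXE u (σ - t / 2) - VXE u (σ + t / 2),
            2 * VYE u σ - VYE u (σ - t / 2) - VYE u (σ + t / 2)] := by
      rw [← clm_vec2_sub, ← clm_vec2_sub, ← clm_vec2_smul]; ring
    have htri := abs_sub_abs_le_abs_sub
      (2 * (2 * Real.sin Sx * VXE u σ + 2 * Real.sin Sy * VYE u σ + fderiv ℝ δ S ![VXE u σ, VYE u σ]))
      ((2 * Real.sin Sx * VXE u (σ - t / 2) + 2 * Real.sin Sy * VYE u (σ - t / 2) +
            fderiv ℝ δ S ![VXE u (σ - t / 2), VYE u (σ - t / 2)]) +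
          (2 * Real.sin Sx * VXE u (σ + t / 2) + 2 * Real.sin Sy * VYE u (σ + t / 2) +
            fderiv ℝ δ S ![VXE u (σ + t / 2), VYE u (σ + t / 2)]))
    rw [hid] at htri
    have h3 := abs_add_le (2 * Real.sin Sx * (2 * VXE u σ - VXE u (σ - t / 2) - VXE u (σ + t / 2)) +
          2 * Real.sin Sy * (2 * VYE u σ - VYE u (σ - t / 2) - VYE u (σ + t / 2)))
      (fderiv ℝ δ S ![2 * VXE u σ - VXE u (σ - t / 2) - VXE u (σ + t / 2),
            2 * VYE u σ - VYE u (σ - t / 2) - VYE u (σ + t / 2)])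
    have h4 := abs_add_le (2 * Real.sin Sx * (2 * VXE u σ - VXE u (σ - t / 2) - VXE u (σ + t / 2)))
          (2 * Real.sin Sy * (2 * VYE u σ - VYE u (σ - t / 2) - VYE u (σ + t / 2)))
    rw [abs_mul, abs_two] at htri
    have hmono : (4 + κ₁) * (AE * t) ≤ (4 + κ₁) * (AE * τ) :=
      mul_le_mul_of_nonneg_left (mul_le_mul_of_nonneg_left htτ hAE0) (by linarith)
    have e : lam' = 2 * lam + (4 + κ₁) * (AE * τ) / 2 := by rw [hlam']; ring
    rw [e]
    linarith
  -- Step 2: localisation of the momentum sum and alignment of `σ`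
  obtain ⟨φ, hsx, hsy, -, -⟩ := exists_near_curve_trig B hμ' hh' hlo' hhi'
  obtain ⟨j, hj⟩ := exists_int_near_of_h3E_small B hδs h2ne hδ hlo hhi hκ hκ₁ hu hμ' hsx hsy σ (hgap σ) hmid
  rw [← hCV, ← hSE, ← hε4] at hj
  -- Step 3: the values on the anti-diagonal through the mean value theorem
  have hval : Real.sin Sx * (VXE u (σ + t / 2) - VXE u (σ - t / 2)) + Real.sin Sy * (VYE u (σ + t / 2) - VYE u (σ - t / 2)) =
      t * (Real.sin Sx * AX + Real.sin Sy * AY) := by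
    linarith [hslope]
  have hξσ : |ξ - σ| ≤ τ / 2 := by
    rw [min_eq_left ht0.le, max_eq_right ht0.le] at hξ
    rw [abs_le]; constructor <;> linarith [hξ.1, hξ.2]
  -- Step 4: alignment of `ξ` with `φ`; the sines of the sum against the perturbed point at `ξ`
  have halign : |φ - ξ - j * π| ≤ B.Cg * ε4 + τ / 2 := by
    calc |φ - ξ - j * π| = |(φ - σ - j * π) + (σ - ξ)| := by ring_nf
      _ ≤ |φ - σ - j * π| + |σ - ξ| := abs_add_le _ _
      _ ≤ B.Cg * ε4 + τ / 2 := add_le_add hj (by rw [abs_sub_comm]; exact hξσ)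
  set νξ := μ - δ (u ξ • dir ξ) with hνξ
  have hνξmem : νξ ∈ Icc a b := shiftedLevel_mem_Icc (hu ξ) hδ' hlo hhi
  obtain ⟨σ', hσ', ax, ay, -, -⟩ := exists_sign_align B hνξmem halign
  have hσabs : |σ'| = 1 := by rcases hσ' with rfl | rfl <;> norm_num
  obtain ⟨hXξ, hYξ⟩ := XE_eq_bandX_shifted B hδ' hlo hhi hu ξ
  have hradφ : |bandFermiRadius μ' φ - bandFermiRadius νξ φ| ≤ 2 * κ₀ / B.Dtmin :=
    (abs_bandFermiRadius_sub_le_of_level B hνξmem hμ' φ).trans (div_le_div_of_nonneg_right (hgap ξ) hDt.le)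
  have s2x : |Real.sin (bandX μ' φ) - Real.sin (bandX νξ φ)| ≤ 2 * κ₀ / B.Dtmin := by
    refine (Real.abs_sin_sub_sin_le _ _).trans ?_
    rw [bandX, bandX, ← sub_mul, abs_mul]
    exact (mul_le_of_le_one_right (abs_nonneg _) (Real.abs_cos_le_one φ)).trans hradφ
  have s2y : |Real.sin (bandY μ' φ) - Real.sin (bandY νξ φ)| ≤ 2 * κ₀ / B.Dtmin := by
    refine (Real.abs_sin_sub_sin_le _ _).trans ?_
    rw [bandY, bandY, ← sub_mul, abs_mul]
    exact (mul_le_of_le_one_right (abs_nonneg _) (Real.abs_sin_le_one φ)).trans hradφ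
  have cx : |σ' * Real.sin Sx - Real.sin (XE u ξ)| ≤ etot := by
    rw [hXξ]
    have e : σ' * Real.sin Sx - Real.sin (bandX νξ ξ) =
        σ' * ((Real.sin Sx - Real.sin (bandX μ' φ)) + (Real.sin (bandX μ' φ) - Real.sin (bandX νξ φ))) +
          (σ' * Real.sin (bandX νξ φ) - Real.sin (bandX νξ ξ)) := by ring
    rw [e]
    refine (abs_add_le _ _).trans ?_
    rw [abs_mul, hσabs, one_mul]
    have := abs_add_le (Real.sin Sx - Real.sin (bandX μ' φ)) (Real.sin (bandX μ' φ) - Real.sin (bandX νξ φ))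
    rw [hetot]; linarith
  have cy : |σ' * Real.sin Sy - Real.sin (YE u ξ)| ≤ etot := by
    rw [hYξ]
    have e : σ' * Real.sin Sy - Real.sin (bandY νξ ξ) =
        σ' * ((Real.sin Sy - Real.sin (bandY μ' φ)) + (Real.sin (bandY μ' φ) - Real.sin (bandY νξ φ))) +
          (σ' * Real.sin (bandY νξ φ) - Real.sin (bandY νξ ξ)) := by ring
    rw [e]
    refine (abs_add_le _ _).trans ?_
    rw [abs_mul, hσabs, one_mul]
    have := abs_add_le (Real.sin Sy - Real.sin (bandY μ' φ)) (Real.sin (bandY μ' φ) - Real.sin (bandY νξ φ))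
    rw [hetot]; linarith
  -- Step 5: the core lower bound through the perturbed fold quantity at `ξ`
  have hR := abs_two_term_sub_le (σ' * Real.sin Sx) (σ' * Real.sin Sy) (Real.sin (XE u ξ)) (Real.sin (YE u ξ)) AX AY
  have hetot0 : 0 ≤ etot := (abs_nonneg _).trans cx
  have bR1 : |σ' * Real.sin Sx - Real.sin (XE u ξ)| * |AX| ≤ etot * AE := mul_le_mul cx hAXb (abs_nonneg _) hetot0
  have bR2 : |σ' * Real.sin Sy - Real.sin (YE u ξ)| * |AY| ≤ etot * AE := mul_le_mul cy hAYb (abs_nonneg _) hetot0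
  have hcore : B.hmin / 2 + κ₁ * AE / 2 ≤ |Real.sin Sx * AX + Real.sin Sy * AY| := by
    have e1 : |σ' * Real.sin Sx * AX + σ' * Real.sin Sy * AY| = |Real.sin Sx * AX + Real.sin Sy * AY| := by
      rw [show σ' * Real.sin Sx * AX + σ' * Real.sin Sy * AY = σ' * (Real.sin Sx * AX + Real.sin Sy * AY) by ring, abs_mul, hσabs,
        one_mul]
    have e2 := abs_sub_abs_le_abs_sub (Real.sin (XE u ξ) * AX + Real.sin (YE u ξ) * AY) (σ' * Real.sin Sx * AX + σ' * Real.sin Sy * AY)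
    rw [abs_sub_comm] at e2
    rw [← e1]
    linarith
  -- Step 6: the `Dδ` part of the `t`-derivative is `≤ κ₁ A_E t / 2`
  have hDpart : |fderiv ℝ δ S ![(VXE u (σ + t / 2) - VXE u (σ - t / 2)) / 2, (VYE u (σ + t / 2) - VYE u (σ - t / 2)) / 2]| ≤
      κ₁ * (AE * t / 2) := by
    refine abs_fderiv_vec2_le (hκ S) (by positivity) ?_ ?_
    · rw [abs_div, abs_two]; linarith
    · rw [abs_div, abs_two]; linarith
  have hmain : B.hmin / 2 * t + κ₁ * (AE * t / 2) ≤ |Real.sin Sx * (VXE u (σ + t / 2) - VXE u (σ - t / 2)) +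
      Real.sin Sy * (VYE u (σ + t / 2) - VYE u (σ - t / 2))| := by
    rw [hval, abs_mul, abs_of_pos ht0]
    have := mul_le_mul_of_nonneg_left hcore ht0.le
    linarith
  have hfin := abs_sub_abs_le_abs_sub
    (Real.sin Sx * (VXE u (σ + t / 2) - VXE u (σ - t / 2)) + Real.sin Sy * (VYE u (σ + t / 2) - VYE u (σ - t / 2)))
    (-(fderiv ℝ δ S ![(VXE u (σ + t / 2) - VXE u (σ - t / 2)) / 2, (VYE u (σ + t / 2) - VYE u (σ - t / 2)) / 2]))
  rw [abs_neg, sub_neg_eq_add] at hfin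
  linarith

end Fold

end Summit.HubbardSuperconductivity.HubbardSuperconductivity.Theorems.PerturbedFermiCurve

end
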